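import Mathlib
import Summits.ResolutionOfSingularities.ResolutionOfSingularities.Theorems.WeightedInvariantLocalWeightedDropInitialFormConeWin

/-!
# `WeightedInvariant.LocalWeightedDrop`, residual T″|₄ `stub_tameWideApexFourStartsWon` (skeleton v31): COVERED START CLASS #1 —
# the weighted-diagonal (Brieskorn–Pham) starts with arbitrary tail are won in ONE move, every dimension, every characteristic
# not dividing the exponents

Crux item stmt-ResolutionOfSingularities-8899 `LocalWeightedDrop` (route `ResolutionOfSingularities/WeightedInvariant`), engine skeleton
v31 (res-L1-w43-lead-1, fb48e93459d3708f), residual stubs T″|₄ `stub_tameWideApexFourStartsWon` / T″|₅₊ / W4|₄ / W4|₅₊ (all `N ≥ 4`).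
[OURS · L1 W4.3, chain w43, res-L1-w43-stub-3 (gen 4) = second hand on plan-1's DEALS gen 9 #26 «N = 4 TAME census + first cut»
(census owner res-L1-w43-stub-1; dealer word 2026-08-27T10:04:18Z: «DELIVERABLE 2 = the kernel instantiation of the first covered start
one dimension up … stub-4's `InitialFormConeWin.won_of_initialForm_offVertex` p518760»).  The tool is res-L1-w43-stub-4's ONE-MOVE WIN
FROM THE INITIAL FORM (semi-quasihomogeneous germs); this file instantiates it on the explicit family every census starts with.
Nothing here is a statement of H. Hironaka's manuscript; the game `CobordantGame.Won` is the programme's own; AI-written, gate-accepted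
means sorry-free with standard axioms, not refereed.  Definition-free.]

THE FAMILY.  `f = Σ_i a_i x_i^{m_i} + R` on `k⟦x_0, …, x_{n-1}⟧`, `a_i ≠ 0`, `(m_i : k) ≠ 0` (every exponent prime to the
characteristic), weights `w_i` with `m_i · w_i = M` for one common `M > 0`, and `R` ANY power series of `w`-order `> M` (the
«tail»; wild or tame, it never matters).  The `w`-initial form `P = Σ a_i x_i^{m_i}` is `w`-homogeneous of weight `M` and its affine
cone is smooth off the origin (`∂_i P = m_i a_i x_i^{m_i − 1}`), so the single move `(X, w)` has no singular successor:
* `isWeightedHomogeneous_diagonal`, `coeff_diagonal_single`, `diagonal_ne_zero`, `eval_pderiv_diagonal`, `cone_diagonal` — the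
  bookkeeping of the diagonal form;
* **`won_diagonal_add_tail`** — `CobordantGame.Won k n (↑(Σ_i C (a_i) * X_i ^ m_i) + R)`, every `n ≥ 1`, every field;
* **`tameWideApexFourStartsWon_of_diagonal`** — the residual T″|₄ `stub_tameWideApexFourStartsWon` (v31 binder shape VERBATIM) under
  the extra hypothesis «`f` is weighted-diagonal plus tail»: COVERED START CLASS #1 of the N = 4 tame census (e.g.
  `x₀^d + x₁^{m₁} + x₂^{m₂} + x₃^{m₃} + tail`, `p ∤ d·m₁·m₂·m₃`, wide-apex whenever `d < m_i`); none of the T″ hypotheses is used —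
  the class is won in W4|₄ and in every dimension alike (`won_diagonal_add_tail`).
-/

set_option linter.dupNamespace false -- mandated namespace of this single-conjunct summit
set_option autoImplicit false

namespace Summit.ResolutionOfSingularities.ResolutionOfSingularities.Theorems

namespace TameN4

open Literature.AlgebraicGeometry.Resolution

variable {k : Type} [Field k] {n : ℕ}

/-- The weighted-diagonal form `Σ_i a_i x_i^{m_i}` is `w`-homogeneous of weight `M` when `m_i · w_i = M` for all `i`. -/
theorem isWeightedHomogeneous_diagonal (m : Fin n → ℕ) (a : Fin n → k) (w : Fin n → ℕ) (M : ℕ) (hmw : ∀ i, m i * w i = M) :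
    (∑ i, MvPolynomial.C (a i) * MvPolynomial.X i ^ (m i) : MvPolynomial (Fin n) k).IsWeightedHomogeneous w M := by
  refine MvPolynomial.IsWeightedHomogeneous.sum Finset.univ _ M fun i _ => ?_
  have h := ((MvPolynomial.isWeightedHomogeneous_X (R := k) w i).pow (m i)).C_mul (a i)
  rwa [smul_eq_mul, hmw i] at h

/-- The coefficient of `x_j^{m_j}` in the diagonal form is `a_j` (exponents positive). -/
theorem coeff_diagonal_single (m : Fin n → ℕ) (a : Fin n → k) (hm : ∀ i, 0 < m i) (j : Fin n) :
    MvPolynomial.coeff (Finsupp.single j (m j)) (∑ i, MvPolynomial.C (a i) * MvPolynomial.X i ^ (m i) : MvPolynomial (Fin n) k) =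
      a j := by
  classical
  rw [MvPolynomial.coeff_sum, Finset.sum_eq_single j]
  · rw [MvPolynomial.coeff_C_mul, MvPolynomial.X_pow_eq_monomial, MvPolynomial.coeff_monomial, if_pos rfl, mul_one]
  · intro i _ hij
    rw [MvPolynomial.coeff_C_mul, MvPolynomial.X_pow_eq_monomial, MvPolynomial.coeff_monomial, if_neg, mul_zero]
    intro h
    rcases Finsupp.single_eq_single_iff _ _ _ _ |>.1 h with ⟨hij', -⟩ | ⟨h0, -⟩
    · exact hij hij'
    · exact absurd h0 (hm i).ne'
  · intro h
    exact absurd (Finset.mem_univ j) h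

/-- The diagonal form is non-zero (some variable exists, exponents positive, coefficients non-zero). -/
theorem diagonal_ne_zero (m : Fin n → ℕ) (a : Fin n → k) (hm : ∀ i, 0 < m i) (ha : ∀ i, a i ≠ 0) (j : Fin n) :
    (∑ i, MvPolynomial.C (a i) * MvPolynomial.X i ^ (m i) : MvPolynomial (Fin n) k) ≠ 0 := by
  intro h
  have hc := coeff_diagonal_single m a hm j
  rw [h, MvPolynomial.coeff_zero] at hc
  exact ha j hc.symm

/-- The gradient of the diagonal form: `∂_j P (c) = a_j · m_j · c_j^{m_j − 1}`. -/
theorem eval_pderiv_diagonal (m : Fin n → ℕ) (a : Fin n → k) (c : Fin n → k) (j : Fin n) :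
    MvPolynomial.eval c (MvPolynomial.pderiv j (∑ i, MvPolynomial.C (a i) * MvPolynomial.X i ^ (m i) : MvPolynomial (Fin n) k)) =
      a j * ((m j : k) * c j ^ (m j - 1)) := by
  classical
  rw [map_sum, map_sum, Finset.sum_eq_single j]
  · rw [MvPolynomial.pderiv_C_mul, MvPolynomial.pderiv_pow, MvPolynomial.pderiv_X_self, mul_one, map_mul, MvPolynomial.eval_C,
      map_mul, map_natCast, map_pow, MvPolynomial.eval_X]
  · intro i _ hij
    rw [MvPolynomial.pderiv_C_mul, MvPolynomial.pderiv_pow, MvPolynomial.pderiv_X_of_ne hij, mul_zero, mul_zero, map_zero]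
  · intro h
    exact absurd (Finset.mem_univ j) h

/-- THE AFFINE CONE OF THE DIAGONAL FORM IS SMOOTH OFF THE ORIGIN when every exponent is prime to the characteristic and every
coefficient is non-zero: `∇P(c) = 0 ⇒ c = 0`. -/
theorem cone_diagonal (m : Fin n → ℕ) (a : Fin n → k) (hm : ∀ i, ((m i : ℕ) : k) ≠ 0) (ha : ∀ i, a i ≠ 0) (c : Fin n → k)
    (hD : ∀ j, MvPolynomial.eval c
      (MvPolynomial.pderiv j (∑ i, MvPolynomial.C (a i) * MvPolynomial.X i ^ (m i) : MvPolynomial (Fin n) k)) = 0) :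
    c = 0 := by
  funext j
  have h := hD j
  rw [eval_pderiv_diagonal] at h
  have hpow : c j ^ (m j - 1) = 0 := by
    rcases mul_eq_zero.1 h with h1 | h1
    · exact absurd h1 (ha j)
    · rcases mul_eq_zero.1 h1 with h2 | h2
      · exact absurd h2 (hm j)
      · exact h2
  by_cases h1 : m j - 1 = 0
  · rw [h1, pow_zero] at hpow
    exact absurd hpow one_ne_zero
  · exact (pow_eq_zero_iff h1).1 hpow

/-- **WEIGHTED-DIAGONAL (BRIESKORN–PHAM) STARTS WITH ARBITRARY TAIL ARE WON IN ONE MOVE**, every dimension `n ≥ 1`, every field: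
`f = Σ_i a_i x_i^{m_i} + R` with `a_i ≠ 0`, `(m_i : k) ≠ 0`, `m_i · w_i = M > 0` and `R` of `w`-order `> M` ⇒ `CobordantGame.Won k n f`
(the move `(X, w)`; res-L1-w43-stub-4's `InitialFormConeWin.won_of_initialForm_offVertex`).  [OURS · L1 W4.3; the family is the
classical semi-quasihomogeneous / Brieskorn–Pham one, cf. Kollár, *Lectures on Resolution of Singularities* (2007) §3.4 for the
weighted blow-up reading] -/
theorem won_diagonal_add_tail (hn : 0 < n) (m : Fin n → ℕ) (a : Fin n → k) (w : Fin n → ℕ) (M : ℕ) (hM : 0 < M)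
    (hmw : ∀ i, m i * w i = M) (hm : ∀ i, ((m i : ℕ) : k) ≠ 0) (ha : ∀ i, a i ≠ 0)
    (R : MvPowerSeries (Fin n) k) (hR : (M : ℕ∞) < R.weightedOrder w) :
    CobordantGame.Won k n
      (((∑ i, MvPolynomial.C (a i) * MvPolynomial.X i ^ (m i) : MvPolynomial (Fin n) k) : MvPowerSeries (Fin n) k) + R) := by
  have hmpos : ∀ i, 0 < m i := fun i => Nat.pos_of_ne_zero fun h => by
    have := hmw i
    rw [h, zero_mul] at this
    exact hM.ne' this.symm
  have hw : ∃ i, 0 < w i := ⟨⟨0, hn⟩, Nat.pos_of_ne_zero fun h => by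
    have := hmw ⟨0, hn⟩
    rw [h, mul_zero] at this
    exact hM.ne' this.symm⟩
  exact InitialFormConeWin.won_of_initialForm_offVertex w hw (isWeightedHomogeneous_diagonal m a w M hmw)
    (diagonal_ne_zero m a hmpos ha ⟨0, hn⟩) (fun c _ _ hD => cone_diagonal m a hm ha c hD) R hR

/-- **COVERED START CLASS #1 OF THE N = 4 TAME RESIDUAL**: `stub_tameWideApexFourStartsWon` (skeleton v31, res-L1-w43-lead-1;
binder shape VERBATIM) holds for the starts that are WEIGHTED-DIAGONAL PLUS TAIL — `f = ↑(Σ_i C (a_i) * X_i ^ m_i) + R` with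
`a_i ≠ 0`, `(m_i : k) ≠ 0`, `m_i · w_i = M > 0`, `R` of `w`-order `> M` (e.g. `x₀^d + x₁^{m₁} + x₂^{m₂} + x₃^{m₃} + tail`,
`p ∤ d·m₁·m₂·m₃`; wide-apex whenever `d < m_i`).  None of the T″ hypotheses is used: the class is won outright by
`won_diagonal_add_tail`. [OURS · L1 W4.3] -/
theorem tameWideApexFourStartsWon_of_diagonal : ∀ (p : ℕ), p.Prime → ∀ (k : Type) [Field k] [CharP k p] [IsAlgClosed k],
    (∀ m : ℕ, m < 4 → ∀ g : MvPowerSeries (Fin m) k,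
      CobordantGame.IsSingular k g → CobordantGame.Won k m g) →
    ∀ (f : MvPowerSeries (Fin 4) k), CobordantGame.IsSingular k f →
    (∀ g : MvPowerSeries (Fin 4) k, CobordantGame.IsSingular k g → g.order < f.order →
      CobordantGame.Won k 4 g) →
    ∀ (d : ℕ), f.order = d → ¬ p ∣ d →
    (∃ ℓ : Fin 4 → k, ∀ i j : Fin 4,
      MvPowerSeries.coeff (Finsupp.single i 1 + Finsupp.single j 1) f =
        MvPowerSeries.coeff (Finsupp.single i 1 + Finsupp.single j 1)
          ((∑ l, MvPowerSeries.C (ℓ l) * MvPowerSeries.X l) ^ 2)) →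
    (2 < d → ∃ c₁ c₂ : Fin 4 → k, (∀ α β : k, α • c₁ + β • c₂ = 0 → α = 0 ∧ β = 0) ∧
      (∀ v : Fin 4 → k, CobordantChart.initEval (fun _ : Fin 4 => 1) (v + c₁) d f =
        CobordantChart.initEval (fun _ : Fin 4 => 1) v d f) ∧
      (∀ v : Fin 4 → k, CobordantChart.initEval (fun _ : Fin 4 => 1) (v + c₂) d f =
        CobordantChart.initEval (fun _ : Fin 4 => 1) v d f)) →
    (∃ (m : Fin 4 → ℕ) (a : Fin 4 → k) (w : Fin 4 → ℕ) (M : ℕ) (R : MvPowerSeries (Fin 4) k),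
      0 < M ∧ (∀ i, m i * w i = M) ∧ (∀ i, ((m i : ℕ) : k) ≠ 0) ∧ (∀ i, a i ≠ 0) ∧ (M : ℕ∞) < R.weightedOrder w ∧
      f = ((∑ i, MvPolynomial.C (a i) * MvPolynomial.X i ^ (m i) : MvPolynomial (Fin 4) k) : MvPowerSeries (Fin 4) k) + R) →
    CobordantGame.Won k 4 f := by
  intro p _ k _ _ _ _ f _ _ d _ _ _ _ hdiag
  obtain ⟨m, a, w, M, R, hM, hmw, hm, ha, hR, rfl⟩ := hdiag
  exact won_diagonal_add_tail (by norm_num) m a w M hM hmw hm ha R hR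

/-! ### Rev 2: PARTIAL diagonal forms — the centre is the coordinate subspace of the missing letters (cuspidal edges,
Brieskorn–Pham cylinders with tail) -/

/-- The partial diagonal form `Σ_{i ∈ S} a_i x_i^{m_i}` is `w`-homogeneous of weight `M` when `m_i · w_i = M` on `S`. -/
theorem isWeightedHomogeneous_partialDiagonal (S : Finset (Fin n)) (m : Fin n → ℕ) (a : Fin n → k) (w : Fin n → ℕ) (M : ℕ)
    (hmw : ∀ i ∈ S, m i * w i = M) :
    (∑ i ∈ S, MvPolynomial.C (a i) * MvPolynomial.X i ^ (m i) : MvPolynomial (Fin n) k).IsWeightedHomogeneous w M := by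
  refine MvPolynomial.IsWeightedHomogeneous.sum S _ M fun i hi => ?_
  have h := ((MvPolynomial.isWeightedHomogeneous_X (R := k) w i).pow (m i)).C_mul (a i)
  rwa [smul_eq_mul, hmw i hi] at h

/-- The coefficient of `x_j^{m_j}`, `j ∈ S`, in the partial diagonal form is `a_j` (exponents positive on `S`). -/
theorem coeff_partialDiagonal_single (S : Finset (Fin n)) (m : Fin n → ℕ) (a : Fin n → k) (hm : ∀ i ∈ S, 0 < m i) {j : Fin n}
    (hj : j ∈ S) :
    MvPolynomial.coeff (Finsupp.single j (m j))
        (∑ i ∈ S, MvPolynomial.C (a i) * MvPolynomial.X i ^ (m i) : MvPolynomial (Fin n) k) = a j := by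
  classical
  rw [MvPolynomial.coeff_sum, Finset.sum_eq_single j]
  · rw [MvPolynomial.coeff_C_mul, MvPolynomial.X_pow_eq_monomial, MvPolynomial.coeff_monomial, if_pos rfl, mul_one]
  · intro i hi hij
    rw [MvPolynomial.coeff_C_mul, MvPolynomial.X_pow_eq_monomial, MvPolynomial.coeff_monomial, if_neg, mul_zero]
    intro h
    rcases Finsupp.single_eq_single_iff _ _ _ _ |>.1 h with ⟨hij', -⟩ | ⟨h0, -⟩
    · exact hij hij'
    · exact absurd h0 (hm i hi).ne'
  · intro h
    exact absurd hj h

/-- The gradient of the partial diagonal form: `∂_j P (c) = a_j · m_j · c_j^{m_j − 1}` for `j ∈ S`. -/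
theorem eval_pderiv_partialDiagonal (S : Finset (Fin n)) (m : Fin n → ℕ) (a : Fin n → k) (c : Fin n → k) {j : Fin n}
    (hj : j ∈ S) :
    MvPolynomial.eval c (MvPolynomial.pderiv j
        (∑ i ∈ S, MvPolynomial.C (a i) * MvPolynomial.X i ^ (m i) : MvPolynomial (Fin n) k)) =
      a j * ((m j : k) * c j ^ (m j - 1)) := by
  classical
  rw [map_sum, map_sum, Finset.sum_eq_single j]
  · rw [MvPolynomial.pderiv_C_mul, MvPolynomial.pderiv_pow, MvPolynomial.pderiv_X_self, mul_one, map_mul, MvPolynomial.eval_C,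
      map_mul, map_natCast, map_pow, MvPolynomial.eval_X]
  · intro i _ hij
    rw [MvPolynomial.pderiv_C_mul, MvPolynomial.pderiv_pow, MvPolynomial.pderiv_X_of_ne hij, mul_zero, mul_zero, map_zero]
  · intro h
    exact absurd hj h

/-- **PARTIAL WEIGHTED-DIAGONAL STARTS WITH TAIL ARE WON IN ONE MOVE** — the centre is the coordinate subspace of the letters OFF the
support `S` (weights `w_i = 0` there): `f = Σ_{i ∈ S} a_i x_i^{m_i} + R`, `S ≠ ∅`, `a_i ≠ 0` and `(m_i : k) ≠ 0` on `S`,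
`m_i · w_i = M > 0` on `S`, `w_i = 0` off `S`, `R` of `w`-order `> M` (so every monomial of `R` carries `w`-weight `> M` in the
letters of `S`) ⇒ `CobordantGame.Won k n f`.  Examples: the cuspidal edge `x₀² + x₁³ + (tail of (3,2,0,0)-weight ≥ 7)` along the
plane `{x₀ = x₁ = 0}` in `k⟦x₀,…,x₃⟧` (`p ≠ 2, 3`); every Brieskorn–Pham form in a subset of the letters. [OURS · L1 W4.3] -/
theorem won_partialDiagonal_add_tail (S : Finset (Fin n)) (hS : S.Nonempty) (m : Fin n → ℕ) (a : Fin n → k) (w : Fin n → ℕ)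
    (M : ℕ) (hM : 0 < M) (hmw : ∀ i ∈ S, m i * w i = M) (hw0 : ∀ i, i ∉ S → w i = 0) (hm : ∀ i ∈ S, ((m i : ℕ) : k) ≠ 0)
    (ha : ∀ i ∈ S, a i ≠ 0) (R : MvPowerSeries (Fin n) k) (hR : (M : ℕ∞) < R.weightedOrder w) :
    CobordantGame.Won k n
      (((∑ i ∈ S, MvPolynomial.C (a i) * MvPolynomial.X i ^ (m i) : MvPolynomial (Fin n) k) : MvPowerSeries (Fin n) k) + R) := by
  obtain ⟨j₀, hj₀⟩ := hS
  have hmpos : ∀ i ∈ S, 0 < m i := fun i hi => Nat.pos_of_ne_zero fun h => by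
    have := hmw i hi
    rw [h, zero_mul] at this
    exact hM.ne' this.symm
  have hwpos : ∀ i ∈ S, 0 < w i := fun i hi => Nat.pos_of_ne_zero fun h => by
    have := hmw i hi
    rw [h, mul_zero] at this
    exact hM.ne' this.symm
  have hP0 : (∑ i ∈ S, MvPolynomial.C (a i) * MvPolynomial.X i ^ (m i) : MvPolynomial (Fin n) k) ≠ 0 := by
    intro h
    have hc := coeff_partialDiagonal_single S m a hmpos hj₀
    rw [h, MvPolynomial.coeff_zero] at hc
    exact ha j₀ hj₀ hc.symm
  refine InitialFormConeWin.won_of_initialForm_offVertex w ⟨j₀, hwpos j₀ hj₀⟩ (isWeightedHomogeneous_partialDiagonal S m a w M hmw)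
    hP0 (fun c hc0 _ hD => ?_) R hR
  funext j
  by_cases hj : j ∈ S
  · have h := hD j
    rw [eval_pderiv_partialDiagonal S m a c hj] at h
    have hpow : c j ^ (m j - 1) = 0 := by
      rcases mul_eq_zero.1 h with h1 | h1
      · exact absurd h1 (ha j hj)
      · rcases mul_eq_zero.1 h1 with h2 | h2
        · exact absurd h2 (hm j hj)
        · exact h2
    by_cases h1 : m j - 1 = 0
    · rw [h1, pow_zero] at hpow
      exact absurd hpow one_ne_zero
    · exact (pow_eq_zero_iff h1).1 hpow
  · exact hc0 j (hw0 j hj)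

/-! ### Rev 3: ONE WILD EXPONENT IS ALLOWED — the value `P(c) = 0` at a singular point of the cone kills the last coordinate
(wild Brieskorn double points `y² + Σ x_i^{m_i}`, `m_i` odd, in characteristic `2`; `x₀³ + …` in characteristic `3`; …) -/

/-- The value of the diagonal form: `P(c) = Σ_i a_i c_i^{m_i}`. -/
theorem eval_diagonal (m : Fin n → ℕ) (a : Fin n → k) (c : Fin n → k) :
    MvPolynomial.eval c (∑ i, MvPolynomial.C (a i) * MvPolynomial.X i ^ (m i) : MvPolynomial (Fin n) k) = ∑ i, a i * c i ^ (m i) := by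
  rw [map_sum]
  refine Finset.sum_congr rfl fun i _ => ?_
  rw [map_mul, MvPolynomial.eval_C, map_pow, MvPolynomial.eval_X]

/-- THE CONE OF THE DIAGONAL FORM IS SMOOTH OFF THE ORIGIN WITH AT MOST ONE WILD EXPONENT: if every exponent except possibly `m_{i₀}` is prime
to the characteristic (all exponents positive, all coefficients non-zero), then `P(c) = 0 ∧ ∇P(c) = 0 ⇒ c = 0` — the gradient kills the tame
coordinates, the value kills the last one. -/
theorem cone_diagonal_oneWild (m : Fin n → ℕ) (a : Fin n → k) (i₀ : Fin n) (hm : ∀ i, i ≠ i₀ → ((m i : ℕ) : k) ≠ 0)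
    (hmpos : ∀ i, 0 < m i) (ha : ∀ i, a i ≠ 0) (c : Fin n → k)
    (hP : MvPolynomial.eval c (∑ i, MvPolynomial.C (a i) * MvPolynomial.X i ^ (m i) : MvPolynomial (Fin n) k) = 0)
    (hD : ∀ j, MvPolynomial.eval c
      (MvPolynomial.pderiv j (∑ i, MvPolynomial.C (a i) * MvPolynomial.X i ^ (m i) : MvPolynomial (Fin n) k)) = 0) :
    c = 0 := by
  -- the tame coordinates vanish by the gradient
  have htame : ∀ j, j ≠ i₀ → c j = 0 := by
    intro j hj
    have h := hD j
    rw [eval_pderiv_diagonal] at h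
    have hpow : c j ^ (m j - 1) = 0 := by
      rcases mul_eq_zero.1 h with h1 | h1
      · exact absurd h1 (ha j)
      · rcases mul_eq_zero.1 h1 with h2 | h2
        · exact absurd h2 (hm j hj)
        · exact h2
    by_cases h1 : m j - 1 = 0
    · rw [h1, pow_zero] at hpow
      exact absurd hpow one_ne_zero
    · exact (pow_eq_zero_iff h1).1 hpow
  -- the value kills the wild coordinate
  have hval : a i₀ * c i₀ ^ (m i₀) = 0 := by
    rw [eval_diagonal, Finset.sum_eq_single i₀] at hP
    · exact hP
    · intro i _ hi
      rw [htame i hi, zero_pow (hmpos i).ne', mul_zero]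
    · intro h
      exact absurd (Finset.mem_univ i₀) h
  have h0 : c i₀ = 0 := by
    rcases mul_eq_zero.1 hval with h1 | h1
    · exact absurd h1 (ha i₀)
    · exact (pow_eq_zero_iff (hmpos i₀).ne').1 h1
  funext j
  by_cases hj : j = i₀
  · rw [hj]; exact h0
  · exact htame j hj

/-- **WEIGHTED-DIAGONAL STARTS WITH ONE WILD EXPONENT ARE WON IN ONE MOVE** (every dimension `n ≥ 1`, every field): as
`won_diagonal_add_tail`, but the exponent `m_{i₀}` of ONE slot may be divisible by the characteristic.  Examples (W4, wild: `p ∣ d`): the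
double points `y² + x₀^{m₀} + x₁^{m₁} + x₂^{m₂} + tail` with all `m_i` ODD in characteristic `2` (stub-4's `won_dp_of_initialForm_offVertex`
is the homogeneous case `m₀ = m₁ = m₂`), `x₀³ + x₁^{m₁} + … ` with `3 ∤ m_i` in characteristic `3`. [OURS · L1 W4.3] -/
theorem won_diagonal_add_tail_oneWild (hn : 0 < n) (m : Fin n → ℕ) (a : Fin n → k) (w : Fin n → ℕ) (M : ℕ) (hM : 0 < M)
    (hmw : ∀ i, m i * w i = M) (i₀ : Fin n) (hm : ∀ i, i ≠ i₀ → ((m i : ℕ) : k) ≠ 0) (ha : ∀ i, a i ≠ 0)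
    (R : MvPowerSeries (Fin n) k) (hR : (M : ℕ∞) < R.weightedOrder w) :
    CobordantGame.Won k n
      (((∑ i, MvPolynomial.C (a i) * MvPolynomial.X i ^ (m i) : MvPolynomial (Fin n) k) : MvPowerSeries (Fin n) k) + R) := by
  have hmpos : ∀ i, 0 < m i := fun i => Nat.pos_of_ne_zero fun h => by
    have := hmw i
    rw [h, zero_mul] at this
    exact hM.ne' this.symm
  have hw : ∃ i, 0 < w i := ⟨⟨0, hn⟩, Nat.pos_of_ne_zero fun h => by
    have := hmw ⟨0, hn⟩
    rw [h, mul_zero] at this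
    exact hM.ne' this.symm⟩
  exact InitialFormConeWin.won_of_initialForm_offVertex w hw (isWeightedHomogeneous_diagonal m a w M hmw)
    (diagonal_ne_zero m a hmpos ha ⟨0, hn⟩) (fun c _ hP hD => cone_diagonal_oneWild m a i₀ hm hmpos ha c hP hD) R hR

/-- **W4|₄, COVERED START CLASS #1-WILD**: `stub_wildWideApexFourStartsWon` (skeleton v31, binder shape VERBATIM) holds for the starts that are
weighted-diagonal plus tail with ONE wild exponent — e.g. the characteristic-`2` double points `y² + x₀^{m₀} + x₁^{m₁} + x₂^{m₂} + tail`,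
`m_i` odd; none of the W4 hypotheses is used. [OURS · L1 W4.3] -/
theorem wildWideApexFourStartsWon_of_diagonal_oneWild : ∀ (p : ℕ), p.Prime → ∀ (k : Type) [Field k] [CharP k p] [IsAlgClosed k],
      (∀ m : ℕ, m < 4 → ∀ g : MvPowerSeries (Fin m) k,
        CobordantGame.IsSingular k g → CobordantGame.Won k m g) →
      ∀ (f : MvPowerSeries (Fin 4) k), CobordantGame.IsSingular k f →
      (∀ g : MvPowerSeries (Fin 4) k, CobordantGame.IsSingular k g → g.order < f.order →
        CobordantGame.Won k 4 g) →
      ∀ (d : ℕ), f.order = d → p ∣ d →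
      (∃ ℓ : Fin 4 → k, ∀ i j : Fin 4,
        MvPowerSeries.coeff (Finsupp.single i 1 + Finsupp.single j 1) f =
          MvPowerSeries.coeff (Finsupp.single i 1 + Finsupp.single j 1)
            ((∑ l, MvPowerSeries.C (ℓ l) * MvPowerSeries.X l) ^ 2)) →
      (2 < d → ∃ c₁ c₂ : Fin 4 → k, (∀ α β : k, α • c₁ + β • c₂ = 0 → α = 0 ∧ β = 0) ∧
        (∀ v : Fin 4 → k, CobordantChart.initEval (fun _ : Fin 4 => 1) (v + c₁) d f =
          CobordantChart.initEval (fun _ : Fin 4 => 1) v d f) ∧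
        (∀ v : Fin 4 → k, CobordantChart.initEval (fun _ : Fin 4 => 1) (v + c₂) d f =
          CobordantChart.initEval (fun _ : Fin 4 => 1) v d f)) →
      (∃ (m : Fin 4 → ℕ) (a : Fin 4 → k) (w : Fin 4 → ℕ) (M : ℕ) (i₀ : Fin 4) (R : MvPowerSeries (Fin 4) k),
        0 < M ∧ (∀ i, m i * w i = M) ∧ (∀ i, i ≠ i₀ → ((m i : ℕ) : k) ≠ 0) ∧ (∀ i, a i ≠ 0) ∧ (M : ℕ∞) < R.weightedOrder w ∧
        f = ((∑ i, MvPolynomial.C (a i) * MvPolynomial.X i ^ (m i) : MvPolynomial (Fin 4) k) : MvPowerSeries (Fin 4) k) + R) →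
      CobordantGame.Won k 4 f := by
  intro p _ k _ _ _ _ f _ _ d _ _ _ _ hdiag
  obtain ⟨m, a, w, M, i₀, R, hM, hmw, hm, ha, hR, rfl⟩ := hdiag
  exact won_diagonal_add_tail_oneWild (by norm_num) m a w M hM hmw i₀ hm ha R hR

end TameN4

end Summit.ResolutionOfSingularities.ResolutionOfSingularities.Theorems
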